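import Literature.MathematicalPhysics.QuantumFieldTheory.Balaban1983to89.B16RatioResummationDefs

/-!
# `Balaban1983to89.B16RatioResummationItems` — item∕weight lemmas and the Kotecký–Preiss ratio step for the RATIO form of the component
# resummation (1.90)–(1.91) of [Balaban1989LargeFieldII] (pp. 387–388), typed for SUBSET polymers (definitions: `B16RatioResummationDefs`)

Second of four files.  Part A: every item has a non-empty footprint (`loc_nonempty` = the sibling `B16Eq190Resummation`'s hypothesis `hout`),
`link_iff` (linked ⟺ footprints meet), `link_symm`.  Part B: **`linkMul_termW`** — print p. 388 *"the expression corresponding to X′₀ factorizes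
in the components"* for the term weight `termW = Π h(X)·Π (e^{−Φ^T(C)} − 1)` (the support conditions split over unlinked families: an attached
cluster is linked to its hole polymer, unlinked hole polymers are compatible) — and `termW_empty`.  Part C: `mem_vacCompat`, `mem_attached`,
`vacCompat_eq_sdiff` and **`gas_compat_eq_mul_sum_mayer`**: in a Kotecký–Preiss volume `Ξ_v(vacCompat Λ S) = Ξ_v(Λ)·Σ_{𝐃 ⊆ attached Λ S} Π_{C∈𝐃}
(e^{−Φ^T(C)} − 1)` — [KoteckyPreiss1986] (5) (tree `LatticeModels.polymerPartitionFunction_sdiff_div_eq_exp`) followed by the Mayer expansion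
`Π(1 + u_C)` (`Finset.prod_one_add`), non-clusters dropped by `LatticeModels.truncatedWeight_eq_zero_of_kp`.

NOT CLAIMED: anything analytic; the identity itself (next file).  No `sorry`; no definitions; no named fact.

References: [Balaban1989LargeFieldII] T. Bałaban, *Large field renormalization. II. Localization, exponentiation, and bounds for the
𝐑 operation*, Commun. Math. Phys. **122** (1989) 355–392, pp. 387–388 (1.90)–(1.91); [KoteckyPreiss1986] R. Kotecký, D. Preiss, *Cluster
expansion for abstract polymer models*, Commun. Math. Phys. **103** (1986) 491–498, (5) and Theorem p. 492; [Dimock2013BalabanII] J. Dimock,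
*The renormalization group according to Balaban II. Large fields*, J. Math. Phys. **54** (2013) 092301, App. F (the same resummation for
scalar fields, template only).
-/

namespace Literature.MathematicalPhysics.QuantumFieldTheory.Balaban1983to89.B16RatioResummation

open Classical
open Finset
open Literature.Probability.LatticeModels
open Literature.MathematicalPhysics.QuantumFieldTheory.Balaban1983to89.B16Eq190Resummation

noncomputable section

variable {α : Type*} [DecidableEq α]

/-! ## Part A. Items: hole polymers and clusters; footprints, links, the term weight -/

/-- Every item has a non-empty footprint (the sibling's hypothesis `hout`). [cite: Balaban1989LargeFieldII, (1.90) p.388] -/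
theorem loc_nonempty (u : Item α) : (out loc (∅ : Finset α) u).Nonempty := by
  rcases u with X | C
  · simpa [out, loc] using X.2
  · obtain ⟨γ, hγ⟩ := C.2.1
    obtain ⟨a, ha⟩ := C.2.2 γ hγ
    refine ⟨a, ?_⟩
    simp only [out, loc, Sum.elim_inr, sdiff_empty, mem_biUnion, id]
    exact ⟨γ, hγ, ha⟩

/-- Two items are linked iff their footprints intersect. [cite: Balaban1989LargeFieldII, (1.90) p.388] -/
theorem link_iff (u w : Item α) : link u w ↔ (loc u ∩ loc w).Nonempty := by
  simp only [link, olink, Touch, out, sdiff_empty, Finset.Nonempty, mem_inter]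
  constructor
  · rintro ⟨a, ha, b, hb, rfl⟩; exact ⟨a, ha, hb⟩
  · rintro ⟨a, ha, hb⟩; exact ⟨a, ha, a, hb, rfl⟩

/-- The link relation is symmetric. [cite: Balaban1989LargeFieldII, (1.90) p.388] -/
theorem link_symm (u w : Item α) (h : link u w) : link w u :=
  olink_symm (fun _ _ h => h.symm) u w h

/-! ## Part B. The term weight factorizes over unlinked families -/

/-- `toLeft` of a union. [folklore] -/
private theorem toLeft_union (S T : Finset (Item α)) : (S ∪ T).toLeft = S.toLeft ∪ T.toLeft := by
  ext X; simp

/-- `toRight` of a union. [folklore] -/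
private theorem toRight_union (S T : Finset (Item α)) : (S ∪ T).toRight = S.toRight ∪ T.toRight := by
  ext C; simp

/-- A cluster attached to a hole polymer is linked to it. [cite: Balaban1989LargeFieldII, (1.90) p.388] -/
theorem link_of_attached {C : CItem α} {X : HItem α} {γ : Finset α} (hγ : γ ∈ C.1) (h : polyInc γ X.1) :
    link (Sum.inr C) (Sum.inl X) := by
  rw [link_iff]
  have hmeet : (γ ∩ X.1).Nonempty := by
    rcases h with h | h
    · rw [h, inter_self]; exact X.2
    · exact h
  obtain ⟨a, ha⟩ := hmeet
  refine ⟨a, ?_⟩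
  simp only [loc, Sum.elim_inr, Sum.elim_inl, mem_inter, mem_biUnion, id] at ha ⊢
  exact ⟨⟨γ, hγ, ha.1⟩, ha.2⟩

/-- Unlinked hole polymers are compatible. [cite: Balaban1989LargeFieldII, (1.90) p.388] -/
theorem not_polyInc_of_not_link {X X' : HItem α} (h : ¬ link (Sum.inl X) (Sum.inl X')) : ¬ polyInc X.1 X'.1 := by
  rw [link_iff] at h
  simp only [loc, Sum.elim_inl] at h
  rintro (heq | hmeet)
  · apply h; rw [heq, inter_self]; exact X'.2
  · exact h hmeet

/-- **`W` factorizes in the components** (`LinkMul`): the support conditions split over unlinked families and the weight is a product.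
[cite: Balaban1989LargeFieldII, (1.90) p.388] -/
theorem linkMul_termW (adm : Finset α → Prop) (Λ : Finset (Finset α)) (h v : Finset α → ℂ) :
    LinkMul link (termW adm Λ h v) := by
  classical
  intro S T hST hun
  have hokiff : TermOk adm Λ (S ∪ T) ↔ TermOk adm Λ S ∧ TermOk adm Λ T := by
    constructor
    · rintro ⟨hadm, hcomp, hcl⟩
      refine ⟨⟨fun X hX => hadm X (by rw [toLeft_union]; exact mem_union_left _ hX),
          fun X hX X' hX' => hcomp X (by rw [toLeft_union]; exact mem_union_left _ hX) X'
            (by rw [toLeft_union]; exact mem_union_left _ hX'),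
          fun C hC => ?_⟩,
        ⟨fun X hX => hadm X (by rw [toLeft_union]; exact mem_union_right _ hX),
          fun X hX X' hX' => hcomp X (by rw [toLeft_union]; exact mem_union_right _ hX) X'
            (by rw [toLeft_union]; exact mem_union_right _ hX'),
          fun C hC => ?_⟩⟩
      · obtain ⟨hΛ, hcl', X, hX, γ, hγ, hγX⟩ := hcl C (by rw [toRight_union]; exact mem_union_left _ hC)
        refine ⟨hΛ, hcl', X, ?_, γ, hγ, hγX⟩
        rw [toLeft_union, mem_union] at hX
        rcases hX with hX | hX
        · exact hX
        · exact absurd (link_of_attached hγ hγX) (hun _ (mem_toRight.1 hC) _ (mem_toLeft.1 hX))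
      · obtain ⟨hΛ, hcl', X, hX, γ, hγ, hγX⟩ := hcl C (by rw [toRight_union]; exact mem_union_right _ hC)
        refine ⟨hΛ, hcl', X, ?_, γ, hγ, hγX⟩
        rw [toLeft_union, mem_union] at hX
        rcases hX with hX | hX
        · exact absurd (link_symm _ _ (link_of_attached hγ hγX))
            (hun _ (mem_toLeft.1 hX) _ (mem_toRight.1 hC))
        · exact hX
    · rintro ⟨⟨hadmS, hcompS, hclS⟩, ⟨hadmT, hcompT, hclT⟩⟩
      refine ⟨fun X hX => ?_, fun X hX X' hX' hne => ?_, fun C hC => ?_⟩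
      · rw [toLeft_union, mem_union] at hX
        exact hX.elim (hadmS X) (hadmT X)
      · rw [toLeft_union, mem_union] at hX hX'
        rcases hX with hX | hX <;> rcases hX' with hX' | hX'
        · exact hcompS X hX X' hX' hne
        · exact not_polyInc_of_not_link (hun _ (mem_toLeft.1 hX) _ (mem_toLeft.1 hX'))
        · exact fun hp => not_polyInc_of_not_link (hun _ (mem_toLeft.1 hX') _ (mem_toLeft.1 hX))
            (Std.Symm.symm _ _ hp)
        · exact hcompT X hX X' hX' hne
      · rw [toRight_union, mem_union] at hC
        rcases hC with hC | hC
        · obtain ⟨hΛ, hcl', X, hX, rest⟩ := hclS C hC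
          exact ⟨hΛ, hcl', X, by rw [toLeft_union]; exact mem_union_left _ hX, rest⟩
        · obtain ⟨hΛ, hcl', X, hX, rest⟩ := hclT C hC
          exact ⟨hΛ, hcl', X, by rw [toLeft_union]; exact mem_union_right _ hX, rest⟩
  have hdisjL : Disjoint S.toLeft T.toLeft := by
    rw [Finset.disjoint_left]; intro X hX hX'
    exact Finset.disjoint_left.1 hST (mem_toLeft.1 hX) (mem_toLeft.1 hX')
  have hdisjR : Disjoint S.toRight T.toRight := by
    rw [Finset.disjoint_left]; intro C hC hC'
    exact Finset.disjoint_left.1 hST (mem_toRight.1 hC) (mem_toRight.1 hC')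
  unfold termW
  by_cases hS : TermOk adm Λ S <;> by_cases hT : TermOk adm Λ T
  · rw [if_pos (hokiff.2 ⟨hS, hT⟩), if_pos hS, if_pos hT, toLeft_union, toRight_union, prod_union hdisjL, prod_union hdisjR]
    ring
  · rw [if_neg (fun h => hT (hokiff.1 h).2), if_neg hT, mul_zero]
  · rw [if_neg (fun h => hS (hokiff.1 h).1), if_neg hS, zero_mul]
  · rw [if_neg (fun h => hS (hokiff.1 h).1), if_neg hS, zero_mul]

/-- `W(∅) = 1`. [cite: Balaban1989LargeFieldII, (1.90) p.388] -/
theorem termW_empty (adm : Finset α → Prop) (Λ : Finset (Finset α)) (h v : Finset α → ℂ) : termW adm Λ h v ∅ = 1 := by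
  classical
  unfold termW
  rw [if_pos]
  · simp [toLeft, toRight]
  · refine ⟨?_, ?_, ?_⟩ <;> simp [toLeft, toRight]

/-! ## Part C. The ratio of vacuum gases as a Mayer sum over attached clusters ([KoteckyPreiss1986] (5)) -/

section Ratio

variable (Λ : Finset (Finset α))

variable {Λ}

/-- Membership in `vacCompat`. [cite: KoteckyPreiss1986, (5)] -/
theorem mem_vacCompat {S : Finset (Finset α)} {γ : Finset α} : γ ∈ vacCompat Λ S ↔ γ ∈ Λ ∧ ∀ X ∈ S, ¬ polyInc γ X := by
  simp only [vacCompat, mem_filter]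

/-- Membership in `attached`. [cite: KoteckyPreiss1986, (5)] -/
theorem mem_attached {S : Finset (Finset α)} {C : Finset (Finset α)} :
    C ∈ attached Λ S ↔ C ⊆ Λ ∧ (∃ γ ∈ C, ∃ X ∈ S, polyInc γ X) ∧ IsPolymerCluster polyInc C := by
  simp only [attached, mem_filter, mem_powerset]

/-- The vacuum polymers compatible with `S` are the catalogue minus the polymers incompatible with `S`. [cite: KoteckyPreiss1986, (5)] -/
theorem vacCompat_eq_sdiff (S : Finset (Finset α)) :
    vacCompat Λ S = Λ \ Λ.filter (fun γ => ∃ X ∈ S, polyInc γ X) := by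
  ext γ
  simp only [mem_vacCompat, mem_filter, mem_sdiff, not_and, not_exists]
  tauto

/-- **[KoteckyPreiss1986] (5) + Mayer**: in a Kotecký–Preiss volume, the vacuum gas of the polymers compatible with `S` equals the full
vacuum gas times `Σ_{𝐃 ⊆ attached clusters} Π_{C∈𝐃} (e^{−Φ^T(C)} − 1)`. [cite: KoteckyPreiss1986, (5)] -/
theorem gas_compat_eq_mul_sum_mayer {v : Finset α → ℂ} {a : Finset α → ℝ} (hKP : IsKPVolume polyInc v a Λ)
    (S : Finset (Finset α)) :
    polymerPartitionFunction polyInc v (vacCompat Λ S) =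
      polymerPartitionFunction polyInc v Λ * ∑ D ∈ (attached Λ S).powerset, ∏ C ∈ D, mayerU v C := by
  classical
  have hZ : polymerPartitionFunction polyInc v Λ ≠ 0 := polymerPartitionFunction_ne_zero_of_kp hKP (Subset.refl _)
  have hratio := polymerPartitionFunction_sdiff_div_eq_exp (D := Λ.filter fun γ => ∃ X ∈ S, polyInc γ X) hKP
  rw [vacCompat_eq_sdiff, ← div_mul_cancel₀ (polymerPartitionFunction polyInc v (Λ \ _)) hZ, hratio, mul_comm]
  congr 1
  -- restrict the cluster sum to genuine clusters (the others have `Φ^T = 0`)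
  have hsum : ∑ C ∈ Λ.powerset with (C ∩ Λ.filter fun γ => ∃ X ∈ S, polyInc γ X).Nonempty, truncatedWeight polyInc v C =
      ∑ C ∈ attached Λ S, truncatedWeight polyInc v C := by
    symm
    refine Finset.sum_subset (fun C hC => ?_) (fun C hC hCn => ?_)
    · obtain ⟨hCΛ, ⟨γ, hγ, hX⟩, -⟩ := mem_attached.1 hC
      exact mem_filter.2 ⟨mem_powerset.2 hCΛ, γ, mem_inter.2 ⟨hγ, mem_filter.2 ⟨hCΛ hγ, hX⟩⟩⟩
    · obtain ⟨hCΛ, γ, hγ⟩ := mem_filter.1 hC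
      have hCΛ' := mem_powerset.1 hCΛ
      refine truncatedWeight_eq_zero_of_kp hKP hCΛ' fun hcl => hCn (mem_attached.2 ⟨hCΛ', ?_, hcl⟩)
      obtain ⟨hγC, hγf⟩ := mem_inter.1 hγ
      exact ⟨γ, hγC, (mem_filter.1 hγf).2⟩
  rw [hsum, ← Finset.sum_neg_distrib, Complex.exp_sum, ← Finset.prod_one_add]
  refine Finset.prod_congr rfl fun C _ => ?_
  simp [mayerU]

end Ratio

end

end Literature.MathematicalPhysics.QuantumFieldTheory.Balaban1983to89.B16RatioResummation
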